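import Literature.NumberTheory.EllipticCurves.PeriodLatticePresentationProofs
import Mathlib.Analysis.Analytic.IsolatedZeros
import HarnessLib

/-!
# Orders of `q`-expansions and growth at the cusp; the `θ`-algebra of the Weierstrass equation

Topic `NumberTheory/EllipticCurves` (toolkit for the "canonical model of `X₀(N)` at CM points"
chain; no new notions beyond the auxiliary `thetaPS`).  Three groups of elementary results:

* **Growth at the cusp from the order of the `q`-expansion** (`exists_tendsto_div_qParam_pow`): for
  a holomorphic `1`-periodic function `φ` on `ℍ`, bounded at `i∞`, with `q`-expansion `Σ cₙqⁿ ≠ 0` of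
  order `n₀`, `φ(τ)/q(τ)^{n₀} → c_{n₀} ≠ 0` as `im τ → ∞` (the cusp function is `q^{n₀}·g(q)` with
  `g(0) ≠ 0`, Mathlib `HasFPowerSeriesAt.eq_pow_order_mul_iterate_dslope`); hence quotients `φ/ψ`
  converge at `i∞` when `ord ψ ≤ ord φ` (`exists_tendsto_div_of_order_le`) and blow up when
  `ord φ < ord ψ` (`tendsto_norm_div_atTop_of_order_lt`) (Diamond–Shurman §1.1, §3.2: orders of
  meromorphic modular functions at the cusp `∞`).
* `tendsto_norm_weierstrassP_eichlerIntegral_atTop` — **`|℘_Λ(2πi∫f)| → ∞` at `i∞`** (`u → 0` and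
  `℘_Λ` has a double pole at `0`).
* **The `θ`-algebra** (`θ = q d/dq`, `thetaPS`): Leibniz rule, commutation with coefficient maps,
  invariance of orders under injective coefficient maps (`order_map_eq`), and the **transfer lemma**
  `odePS_eq_zero_of_mul_eq`: the cleared Weierstrass equation
  `(bθa − aθb)² = e²b(4a³ − g₂ab² − g₃b³)` passes from a pair `(A, B)` to any pair `(a, b)` with
  `aB = bA` (the Wronskian `bθa − aθb` scales with the square of the common factor).

Everything is proved; no named facts are introduced.

## References

* F. Diamond, J. Shurman, *A First Course in Modular Forms*, GTM 228, 2005, §1.1, §3.2.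
  [DiamondShurman2005]
* D. Zagier, *Elliptic modular forms and their applications* (1-2-3 of modular forms), 2008, §5.1.
  [Zagier123]
-/

noncomputable section

open Complex Filter Topology Set Function PowerSeries
open UpperHalfPlane hiding I
open scoped Real Topology Manifold MatrixGroups PeriodPair ModularForm
open CongruenceSubgroup

open Literature.NumberTheory.EllipticCurves

namespace Literature.NumberTheory.EllipticCurves.ModularForms

/-! ### The operator `θ = q d/dq` on `ℂ⟦q⟧` -/

/-- `θ = q d/dq` on formal power series: `θ(Σ aₙqⁿ) = Σ n aₙ qⁿ` (the expression used in the tree's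
`map_odePS`, `odeFun_eq_zero_iff`). [folklore] -/
def thetaPS (x : ℂ⟦X⟧) : ℂ⟦X⟧ := PowerSeries.mk fun n ↦ (n : ℂ) * coeff n x

/-- Unfolding (the literal form of the tree's statements). [folklore] -/
theorem thetaPS_def (x : ℂ⟦X⟧) : thetaPS x = PowerSeries.mk fun n ↦ (n : ℂ) * coeff n x := rfl

/-- Coefficients of `θx`. [folklore] -/
@[simp] theorem coeff_thetaPS (n : ℕ) (x : ℂ⟦X⟧) : coeff n (thetaPS x) = n * coeff n x := by
  rw [thetaPS, coeff_mk]

/-- `θ` is additive. [folklore] -/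
theorem thetaPS_add (x y : ℂ⟦X⟧) : thetaPS (x + y) = thetaPS x + thetaPS y := by
  ext n; simp [mul_add]

/-- `θ` of a difference. [folklore] -/
theorem thetaPS_sub (x y : ℂ⟦X⟧) : thetaPS (x - y) = thetaPS x - thetaPS y := by
  ext n; simp [mul_sub]

/-- **Leibniz rule** `θ(xy) = θx·y + x·θy`. [folklore] -/
theorem thetaPS_mul (x y : ℂ⟦X⟧) : thetaPS (x * y) = thetaPS x * y + x * thetaPS y := by
  ext n
  rw [coeff_thetaPS, map_add, coeff_mul, coeff_mul, coeff_mul, Finset.mul_sum, ← Finset.sum_add_distrib]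
  refine Finset.sum_congr rfl fun p hp ↦ ?_
  rw [Finset.mem_antidiagonal] at hp
  rw [coeff_thetaPS, coeff_thetaPS, ← hp, Nat.cast_add]
  ring

/-- `θ` commutes with coefficientwise ring homomorphisms. [folklore] -/
theorem map_thetaPS' (σ : ℂ →+* ℂ) (x : ℂ⟦X⟧) : (thetaPS x).map σ = thetaPS (x.map σ) := by
  ext n; simp [coeff_map]

/-! ### The transfer lemma for the cleared Weierstrass equation -/

/-- **Wronskian scaling**: if `aB = bA` then `(bθa − aθb)·B² = (BθA − AθB)·b²`. [folklore] -/
theorem wronskian_mul_sq_eq {A B a b : ℂ⟦X⟧} (hB : B ≠ 0) (hR : a * B = b * A) :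
    (b * thetaPS a - a * thetaPS b) * B ^ 2 = (B * thetaPS A - A * thetaPS B) * b ^ 2 := by
  have hθR : thetaPS a * B + a * thetaPS B = thetaPS b * A + b * thetaPS A := by
    have := congrArg thetaPS hR
    rwa [thetaPS_mul, thetaPS_mul] at this
  have hP : ((b * thetaPS a - a * thetaPS b) * B ^ 2 - (B * thetaPS A - A * thetaPS B) * b ^ 2) * B = 0 := by
    linear_combination (-(thetaPS b * B ^ 2 + thetaPS B * b * B)) * hR + (b * B ^ 2) * hθR
  rcases mul_eq_zero.mp hP with h | h
  · exact sub_eq_zero.mp h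
  · exact absurd h hB

/-- The cubic side scales with the fourth power: `b(4a³ − g₂ab² − g₃b³)·B⁴ = B(4A³ − g₂AB² − g₃B³)·b⁴`
if `aB = bA`. [folklore] -/
theorem cubic_mul_pow_four_eq {A B a b : ℂ⟦X⟧} (hR : a * B = b * A) (g₂ g₃ : ℂ) :
    b * (4 * a ^ 3 - PowerSeries.C g₂ * a * b ^ 2 - PowerSeries.C g₃ * b ^ 3) * B ^ 4 =
      B * (4 * A ^ 3 - PowerSeries.C g₂ * A * B ^ 2 - PowerSeries.C g₃ * B ^ 3) * b ^ 4 := by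
  linear_combination (4 * b * B * (a ^ 2 * B ^ 2 + a * b * A * B + b ^ 2 * A ^ 2) -
    PowerSeries.C g₂ * b ^ 3 * B ^ 3) * hR

/-- **Transfer of the cleared Weierstrass equation along `aB = bA`**: if `B ≠ 0`, `aB = bA` and
`(BθA − AθB)² − e²B(4A³ − g₂AB² − g₃B³) = 0`, then `(bθa − aθb)² − e²b(4a³ − g₂ab² − g₃b³) = 0`.
(Both pairs represent the same "function" `a/b = A/B`; `θ(a/b)² = e²(4(a/b)³ − g₂(a/b) − g₃)` is
intrinsic.) [folklore] -/
theorem odePS_eq_zero_of_mul_eq {A B a b e : ℂ⟦X⟧} (hB : B ≠ 0) (hR : a * B = b * A) (g₂ g₃ : ℂ)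
    (hode : (B * thetaPS A - A * thetaPS B) ^ 2 -
      e ^ 2 * B * (4 * A ^ 3 - PowerSeries.C g₂ * A * B ^ 2 - PowerSeries.C g₃ * B ^ 3) = 0) :
    (b * thetaPS a - a * thetaPS b) ^ 2 -
      e ^ 2 * b * (4 * a ^ 3 - PowerSeries.C g₂ * a * b ^ 2 - PowerSeries.C g₃ * b ^ 3) = 0 := by
  have h1 := wronskian_mul_sq_eq hB hR
  have h2 := cubic_mul_pow_four_eq hR g₂ g₃
  have key : ((b * thetaPS a - a * thetaPS b) ^ 2 -
      e ^ 2 * b * (4 * a ^ 3 - PowerSeries.C g₂ * a * b ^ 2 - PowerSeries.C g₃ * b ^ 3)) * B ^ 4 = 0 := by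
    have h1' : ((b * thetaPS a - a * thetaPS b) * B ^ 2) ^ 2 = ((B * thetaPS A - A * thetaPS B) * b ^ 2) ^ 2 := by
      rw [h1]
    linear_combination h1' - e ^ 2 * h2 + b ^ 4 * hode
  rcases mul_eq_zero.mp key with h | h
  · exact h
  · exact absurd (pow_eq_zero_iff (by norm_num) |>.mp h) hB

/-! ### Orders of power series under coefficient maps and cross relations -/

/-- An injective coefficient map preserves the order. [folklore] -/
theorem order_map_eq {σ : ℂ →+* ℂ} (hσ : Injective σ) (x : ℂ⟦X⟧) : (x.map σ).order = x.order := by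
  apply le_antisymm
  · refine le_order _ _ fun i hi ↦ ?_
    have h0 : coeff i (x.map σ) = 0 := coeff_of_lt_order i hi
    rw [coeff_map] at h0
    exact hσ (by rw [h0, map_zero])
  · refine le_order _ _ fun i hi ↦ ?_
    rw [coeff_map, coeff_of_lt_order i hi, map_zero]

/-- **Orders along a cross relation**: if `a'·B = b'·A` with all four series nonzero then
`ord a' + ord B = ord b' + ord A`. [folklore] -/
theorem order_add_order_eq {A B a' b' : ℂ⟦X⟧} (hR : a' * B = b' * A) :
    a'.order + B.order = b'.order + A.order := by
  rw [← order_mul, ← order_mul, hR]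

/-! ### Growth at the cusp from the order of the `q`-expansion -/

section Growth

variable {φ ψ : ℍ → ℂ}

/-- The order of the `q`-expansion of `φ`, as a natural number (junk `0` for `φ` with zero expansion).
[folklore] -/
def qOrder (φ : ℍ → ℂ) : ℕ := (qExpansion 1 φ).order.toNat

/-- **Leading behaviour at the cusp.**  For `φ` holomorphic, `1`-periodic, bounded at `i∞`, with
nonzero `q`-expansion of order `n₀ = qOrder φ`: `φ(τ)/q(τ)^{n₀} → ℓ ≠ 0` as `im τ → ∞`. [folklore] -/
theorem exists_tendsto_div_qParam_pow (hper : Periodic (φ ∘ ofComplex) 1) (hmd : MDiff φ)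
    (hbd : IsBoundedAtImInfty φ) (h0 : qExpansion 1 φ ≠ 0) :
    ∃ ℓ : ℂ, ℓ ≠ 0 ∧
      Tendsto (fun τ : ℍ ↦ φ τ / Periodic.qParam 1 τ ^ qOrder φ) atImInfty (𝓝 ℓ) := by
  set Φ := cuspFunction 1 φ with hΦ
  set c : ℕ → ℂ := fun m ↦ coeff m (qExpansion 1 φ) with hc
  have hΦa : AnalyticAt ℂ Φ 0 := analyticAt_cuspFunction_zero one_pos hper hmd hbd
  have hsum : ∀ τ : ℍ, HasSum (fun m ↦ c m • Periodic.qParam 1 τ ^ m) (φ τ) := fun τ ↦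
    hasSum_qExpansion one_pos hper hmd hbd τ
  set p : FormalMultilinearSeries ℂ ℂ ℂ := FormalMultilinearSeries.ofScalars ℂ c with hp
  have hps : HasFPowerSeriesAt Φ p 0 :=
    (hasFPowerSeriesOnBall_cuspFunction one_pos hΦa hsum).hasFPowerSeriesAt
  have hp0 : p ≠ 0 := by
    intro hp0
    apply h0
    ext m
    have : p m = 0 := by rw [hp0]; rfl
    rw [hp, FormalMultilinearSeries.ofScalars_eq_zero] at this
    simpa [hc] using this
  -- the two orders agree
  have hord : (qExpansion 1 φ).order = p.order := by
    rw [order_eq_nat]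
    constructor
    · have := p.apply_order_ne_zero hp0
      rwa [hp, Ne, FormalMultilinearSeries.ofScalars_eq_zero] at this
    · intro i hi
      have := p.apply_eq_zero_of_lt_order hi
      rwa [hp, FormalMultilinearSeries.ofScalars_eq_zero] at this
  have hn : qOrder φ = p.order := by rw [qOrder, hord]; rfl
  -- factorisation `Φ = q^{n₀} g`
  set g : ℂ → ℂ := (swap dslope (0 : ℂ))^[p.order] Φ with hg
  have hg0 : g 0 ≠ 0 := hps.iterate_dslope_fslope_ne_zero hp0
  have hgc : ContinuousAt g 0 := (hps.has_fpower_series_iterate_dslope_fslope p.order).continuousAt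
  have hfac : ∀ z, Φ z = z ^ p.order * g z := fun z ↦ by
    have := hps.eq_pow_order_mul_iterate_dslope z
    simpa [sub_zero, smul_eq_mul] using this
  refine ⟨g 0, hg0, ?_⟩
  have hq : Tendsto (fun τ : ℍ ↦ Periodic.qParam 1 τ) atImInfty (𝓝 0) := qParam_tendsto_atImInfty one_pos
  have hlim : Tendsto (fun τ : ℍ ↦ g (Periodic.qParam 1 τ)) atImInfty (𝓝 (g 0)) := hgc.tendsto.comp hq
  refine hlim.congr fun τ ↦ ?_
  have hqne : Periodic.qParam 1 τ ≠ 0 := by simp [Periodic.qParam, Complex.exp_ne_zero]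
  rw [hn, show φ τ = Φ (Periodic.qParam 1 τ) from (eq_cuspFunction τ one_ne_zero hper).symm, hfac,
    mul_div_cancel_left₀ _ (pow_ne_zero _ hqne)]

/-- A function with nonzero `q`-expansion does not vanish for `im τ` large. [folklore] -/
theorem eventually_ne_zero_atImInfty (hper : Periodic (φ ∘ ofComplex) 1) (hmd : MDiff φ)
    (hbd : IsBoundedAtImInfty φ) (h0 : qExpansion 1 φ ≠ 0) : ∀ᶠ τ : ℍ in atImInfty, φ τ ≠ 0 := by
  obtain ⟨ℓ, hℓ, hlim⟩ := exists_tendsto_div_qParam_pow hper hmd hbd h0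
  filter_upwards [hlim.eventually_ne hℓ] with τ hτ
  intro h0'
  apply hτ
  rw [h0', zero_div]

/-- **Quotients converge at the cusp when `ord ψ ≤ ord φ`.** [folklore] -/
theorem exists_tendsto_div_of_order_le (hφper : Periodic (φ ∘ ofComplex) 1) (hφmd : MDiff φ)
    (hφbd : IsBoundedAtImInfty φ) (hφ0 : qExpansion 1 φ ≠ 0)
    (hψper : Periodic (ψ ∘ ofComplex) 1) (hψmd : MDiff ψ) (hψbd : IsBoundedAtImInfty ψ)
    (hψ0 : qExpansion 1 ψ ≠ 0) (hle : qOrder ψ ≤ qOrder φ) :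
    ∃ c : ℂ, Tendsto (fun τ : ℍ ↦ φ τ / ψ τ) atImInfty (𝓝 c) := by
  obtain ⟨ℓ, hℓ, hφlim⟩ := exists_tendsto_div_qParam_pow hφper hφmd hφbd hφ0
  obtain ⟨ℓ', hℓ', hψlim⟩ := exists_tendsto_div_qParam_pow hψper hψmd hψbd hψ0
  have hq : Tendsto (fun τ : ℍ ↦ Periodic.qParam 1 τ) atImInfty (𝓝 0) := qParam_tendsto_atImInfty one_pos
  have hqpow : Tendsto (fun τ : ℍ ↦ Periodic.qParam 1 τ ^ (qOrder φ - qOrder ψ)) atImInfty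
      (𝓝 ((0 : ℂ) ^ (qOrder φ - qOrder ψ))) := hq.pow _
  refine ⟨ℓ / ℓ' * (0 : ℂ) ^ (qOrder φ - qOrder ψ), ?_⟩
  have hlim := (hφlim.div hψlim hℓ').mul hqpow
  apply hlim.congr'
  filter_upwards [eventually_ne_zero_atImInfty hψper hψmd hψbd hψ0] with τ hψτ
  have hqne : Periodic.qParam 1 τ ≠ 0 := by simp [Periodic.qParam, Complex.exp_ne_zero]
  have hpowφ : Periodic.qParam 1 τ ^ qOrder φ = Periodic.qParam 1 τ ^ qOrder ψ *
      Periodic.qParam 1 τ ^ (qOrder φ - qOrder ψ) := by rw [← pow_add, Nat.add_sub_cancel' hle]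
  simp only [Pi.div_apply]
  rw [hpowφ]
  field_simp

/-- **Quotients blow up at the cusp when `ord φ < ord ψ`.** [folklore] -/
theorem tendsto_norm_div_atTop_of_order_lt (hφper : Periodic (φ ∘ ofComplex) 1) (hφmd : MDiff φ)
    (hφbd : IsBoundedAtImInfty φ) (hφ0 : qExpansion 1 φ ≠ 0)
    (hψper : Periodic (ψ ∘ ofComplex) 1) (hψmd : MDiff ψ) (hψbd : IsBoundedAtImInfty ψ)
    (hψ0 : qExpansion 1 ψ ≠ 0) (hlt : qOrder φ < qOrder ψ) :
    Tendsto (fun τ : ℍ ↦ ‖φ τ / ψ τ‖) atImInfty atTop := by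
  obtain ⟨ℓ, hℓ, hφlim⟩ := exists_tendsto_div_qParam_pow hφper hφmd hφbd hφ0
  obtain ⟨ℓ', hℓ', hψlim⟩ := exists_tendsto_div_qParam_pow hψper hψmd hψbd hψ0
  have hq : Tendsto (fun τ : ℍ ↦ Periodic.qParam 1 τ) atImInfty (𝓝 0) := qParam_tendsto_atImInfty one_pos
  set d := qOrder ψ - qOrder φ with hd
  have hdpos : 0 < d := by omega
  -- `‖q‖^d → 0⁺`, so its inverse tends to `+∞`
  have hqn : Tendsto (fun τ : ℍ ↦ ‖Periodic.qParam 1 τ‖ ^ d) atImInfty (𝓝[>] 0) := by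
    refine tendsto_nhdsWithin_iff.mpr ⟨?_, Eventually.of_forall fun τ ↦ ?_⟩
    · have := (hq.norm).pow d
      rwa [norm_zero, zero_pow hdpos.ne'] at this
    · exact pow_pos (norm_pos_iff.mpr (by simp [Periodic.qParam, Complex.exp_ne_zero])) d
  have hinv : Tendsto (fun τ : ℍ ↦ (‖Periodic.qParam 1 τ‖ ^ d)⁻¹) atImInfty atTop :=
    tendsto_inv_nhdsGT_zero.comp hqn
  have hrat : Tendsto (fun τ : ℍ ↦ ‖(φ τ / Periodic.qParam 1 τ ^ qOrder φ) /
      (ψ τ / Periodic.qParam 1 τ ^ qOrder ψ)‖) atImInfty (𝓝 ‖ℓ / ℓ'‖) := (hφlim.div hψlim hℓ').norm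
  have hpos : 0 < ‖ℓ / ℓ'‖ := norm_pos_iff.mpr (div_ne_zero hℓ hℓ')
  have := Filter.Tendsto.pos_mul_atTop hpos hrat hinv
  apply this.congr'
  filter_upwards [eventually_ne_zero_atImInfty hψper hψmd hψbd hψ0] with τ hψτ
  have hqne : Periodic.qParam 1 τ ≠ 0 := by simp [Periodic.qParam, Complex.exp_ne_zero]
  have hpowψ : Periodic.qParam 1 τ ^ qOrder ψ = Periodic.qParam 1 τ ^ qOrder φ * Periodic.qParam 1 τ ^ d := by
    rw [← pow_add, hd, Nat.add_sub_cancel' hlt.le]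
  rw [hpowψ, ← norm_pow, ← norm_inv, ← norm_mul]
  congr 1
  field_simp

end Growth

/-! ### `|℘_Λ(2πi∫f)| → ∞` at `i∞` -/

variable {N : ℕ} [NeZero N]

/-- The Eichler integral is a cuspidal `q`-series (of period `N`): in particular `u(τ) → 0` at `i∞`.
[folklore] -/
theorem isCuspFunction_eichlerIntegral (f : CuspForm (Gamma0 N) 2) : IsCuspFunction N (eichlerIntegral f) := by
  have := isCuspFunction_verticalIntegral_slash f 1
  rwa [SlashAction.slash_one] at this

/-- **`|℘_Λ(u(τ))| → ∞` as `im τ → ∞`** (`u → 0 ∈ Λ` avoiding the lattice for `im τ` large, and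
`℘_Λ` has a double pole at `0`). [folklore] -/
theorem tendsto_norm_weierstrassP_eichlerIntegral_atTop (f : CuspForm (Gamma0 N) 2) (hf : f ≠ 0)
    (L : PeriodPair) :
    Tendsto (fun τ : ℍ ↦ ‖℘[L] (eichlerIntegral f τ)‖) atImInfty atTop := by
  have hu0 : Tendsto (eichlerIntegral f) atImInfty (𝓝 0) := (isCuspFunction_eichlerIntegral f).isZeroAtImInfty
  obtain ⟨T, hT⟩ := exists_forall_eichlerIntegral_smul_notMem f hf L 1
  have hne : ∀ᶠ τ : ℍ in atImInfty, eichlerIntegral f τ ≠ 0 := by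
    rw [atImInfty, Filter.eventually_comap]
    filter_upwards [Filter.eventually_ge_atTop T] with t ht τ hτ
    intro h0
    have := hT τ (by rw [← hτ] at ht; exact ht)
    rw [one_smul, h0] at this
    exact this L.lattice.zero_mem
  have hu : Tendsto (eichlerIntegral f) atImInfty (𝓝[≠] 0) :=
    tendsto_nhdsWithin_iff.mpr ⟨hu0, hne⟩
  have hord : meromorphicOrderAt ℘[L] 0 < 0 := by
    rw [L.order_weierstrassP 0 L.lattice.zero_mem]; decide
  have h℘ := tendsto_cobounded_of_meromorphicOrderAt_neg hord
  rw [← tendsto_norm_atTop_iff_cobounded] at h℘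
  exact h℘.comp hu

end Literature.NumberTheory.EllipticCurves.ModularForms

end
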